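import Literature.AnabelianGeometry.EtaleTheta.SettingModelSlice2Pinned
import HarnessLib

/-!
# (L3′) slice 2, file 9/13 — the torus `U‴`, cusps of the vertex groups are cusp-diagonal (S7/S8′ (i) `psi_parallelCusp`), conjugate `b`-powers, the degree `ê` on vertex groups

Part of the (L3′) slice-2 chain (abc-iut-L6-t19; FILING SHAPE derived from scratch v5 `Slice2TheoremR2ScratchV5.lean`
551b982286441a66 by the edits E1–E4/D1–D3/H1–H2 of FILING-PLAN-SLICE2.md 9643c7e42a42ad24 and the OPTION-L re-cut of §F v1.19gz (W):
one definitions file + twelve theorem files).  Classical profinite group theory about OUR semi-synthetic `F₂hatT`; the objects and laws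
are those of the one-sentence residual of record (cf. [EtTh] §1, §2 for the role they play there — nothing of [EtTh]/[IUTchII]/[IUTchIII]
in print is asserted; no side on [IUTchIII] Cor. 3.12; MORATORIUM (E): no application to `hext_at_iff_exists_f2hatAut_of_eq`).
-/

noncomputable section

open scoped Pointwise

namespace Literature.AnabelianGeometry.EtaleTheta.SettingModel.Slice2

open Literature.AnabelianGeometry.EtaleTheta.SettingModel
open Literature.AnabelianGeometry.EtaleTheta (ZHatLevel.level ZHatLevel.levelChar)
open Literature.AnabelianGeometry.SemiGraphs (GQp)
open Literature.AnabelianGeometry.AbsoluteAnabelian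
open Literature.AnabelianGeometry.AbsoluteAnabelian.AbsTopII
open _root_.Topology

/-- **Conjugation commutes with `Ẑ`-powers**: `(g x g⁻¹)^t = g x^t g⁻¹` — a file-private copy of the landed
`SettingModel.powHat_conj` (its home is an (E)-class module that this chain does not import; R2′ of §F v1.19gz (W)(4)).
[cite: MochizukiEtTh2009, §1 p.12] -/
private theorem powHat_conj (g x : F₂hatT) (t : ZH) : powHat (g * x * g⁻¹) t = g * powHat x t * g⁻¹ := by
  let C : F₂hatT →ₜ* F₂hatT :=
    { toMonoidHom := (MulAut.conj g).toMonoidHom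
      continuous_toFun := (continuous_const.mul continuous_id).mul continuous_const }
  have hC : ∀ y, C y = g * y * g⁻¹ := fun _ => rfl
  have h := map_powHat C x t
  rw [hC, hC] at h
  exact h.symm

/-! ## §13 (S7 of PL3-R2) THE END VERTICES ARE CUSP-DIAGONAL: `Ψ′(β_c b^v β_c⁻¹) = β_c b^μ β_c⁻¹` for the
cusps of `V_0` (`β_c = β_1^k`) and of `V_{−1}` (`β_c = β_{−1}^k`), every `k ∈ Ẑ` -/

section EndVertices

variable {p : ℕ} [Fact p.Prime] {l : ℕ+} {U₀ : Subgroup (GQp p)} {m : ℕ+} {f' : F₂hatT} {Ψ : F₂hatT → F₂hatT}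

/-- [cite: MochizukiEtTh2009, §1 p.12] -/
theorem finiteIndex_U3 (p : ℕ) [Fact p.Prime] (l : ℕ+) (U₀ : Subgroup (GQp p)) [U₀.FiniteIndex] :
    (U3 p l U₀).FiniteIndex := by
  haveI := finiteIndex_torusCong p l
  infer_instance

/-- For `σ ∈ U^{(l)}`: the axis element `β_s^{χ(σ)k · k⁻¹}` lies in `Û_l` (its exponent is `≡ 0 mod l`).
[cite: MochizukiEtTh2009, §1 p.12] -/
theorem betaPow_chi_div_mem_Uhat {σ : GQp p} (hσ : σ ∈ torusCong p l) (s k : ZH) :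
    betaPow s (chi p σ k * k⁻¹) ∈ Uhat l :=
  betaPow_mem_Uhat_of_level_eq_one s (level_chi_mul_inv_eq_one p hσ k)

/-- `θ_σ(β_ℓ^k) = β_ℓ^{χk·k⁻¹} · β_ℓ^k` — the twist moves a line element by an AXIS CUSP factor.
[cite: MochizukiEtTh2009, §1 p.12] -/
theorem twist_betaPow_eq_mul (σ : GQp p) (ℓ k : ZH) :
    twist (chi p σ) (betaPow ℓ k) = betaPow ℓ (chi p σ k * k⁻¹) * betaPow ℓ k := by
  rw [twist_betaPow, ← betaPow_mul, inv_mul_cancel_right]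

/-- Images of elements of `Û_l` lie in `Û_l` once `f′` normalises. [cite: MochizukiEtTh2009, §1 p.12] -/
theorem AxisPinned.psi_mem_Uhat (H : AxisPinned p l U₀ m f' Ψ) {x : F₂hatT} (hx : x ∈ Uhat l) : Ψ x ∈ Uhat l := by
  have := H.res.mapsTo x hx
  rwa [H.normal] at this

/-- `Ψ′` fixes every axis line element `β_{η i}^u` lying in `Û_l` — restated. [cite: MochizukiEtTh2009, §1 p.12] -/
theorem AxisPinned.psi_axis (H : AxisPinned p l U₀ m f' Ψ) (i : ℤ) {u : ZH} (hu : betaPow (ZHatLevel.eta i) u ∈ Uhat l) :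
    Ψ (betaPow (ZHatLevel.eta i) u) = betaPow (ZHatLevel.eta i) u :=
  H.cusp_fixed i u hu

/-! ### S8′ (i): PARALLEL cusps (composite `l`) — the end-cusp lemma with a general axis cusp line -/

/-- **S8′ (i) — PARALLEL CUSPS ARE CUSP-DIAGONAL.**  For a vertex `P_{η j₀}` with its two lines `η i₀ ≠ η i₁`
(`{η i₀, η i₁} = {η j₀, η j₀ · η 1}`), any conjugator `β_{η i₀}^k` and any non-trivial `β_{η i₁}^v ∈ Û_l`:
`Ψ′(β_{i₀}^k β_{i₁}^v β_{i₀}^{-k}) = β_{i₀}^k β_{i₁}^μ β_{i₀}^{-k}` with `b^μ ≠ 1` (θ-transport + exact `D′` + the wreath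
lemma, as for the end cusps). [cite: MochizukiEtTh2009, §1 p.12] -/
theorem AxisPinned.psi_parallelCusp (H : AxisPinned p l U₀ m f' Ψ) [U₀.FiniteIndex]
    {j₀ i₀ i₁ : ℤ} (hi : i₀ ≠ i₁)
    (hopt : ZHatLevel.eta i₀ = ZHatLevel.eta j₀ ∧ ZHatLevel.eta i₁ = ZHatLevel.eta j₀ * zOne ∨
      ZHatLevel.eta i₀ = ZHatLevel.eta j₀ * zOne ∧ ZHatLevel.eta i₁ = ZHatLevel.eta j₀)
    (k v : ZH) (hv : bPow v ≠ 1) (hvU : betaPow (ZHatLevel.eta i₁) v ∈ Uhat l) :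
    ∃ μ : ZH, bPow μ ≠ 1 ∧
      Ψ (betaPow (ZHatLevel.eta i₀) k * betaPow (ZHatLevel.eta i₁) v * (betaPow (ZHatLevel.eta i₀) k)⁻¹) =
        betaPow (ZHatLevel.eta i₀) k * betaPow (ZHatLevel.eta i₁) μ * (betaPow (ZHatLevel.eta i₀) k)⁻¹ := by
  haveI := finiteIndex_U3 p l U₀
  set r₀ := ZHatLevel.eta j₀ with hr₀
  set ℓ := ZHatLevel.eta i₀ with hℓ
  set ℓ' := ZHatLevel.eta i₁ with hℓ'
  set βc := betaPow ℓ k with hβc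
  set y := βc * betaPow ℓ' v * βc⁻¹ with hy
  -- memberships at the vertex `r₀`: the conjugator and the `b`-powers lie in `P_{r₀}`
  have hmemc : ∀ k' : ZH, (aPow r₀)⁻¹ * betaPow ℓ k' * aPow r₀ ∈ DehnTwist.vertGp := by
    intro k'
    rcases hopt with ⟨h1, -⟩ | ⟨h1, -⟩
    · rw [h1]; exact conj_betaPow_mem_vertGp _ _
    · rw [h1]; exact conj_betaPow_succ_mem_vertGp _ _
  have hmemb : ∀ v' : ZH, (aPow r₀)⁻¹ * betaPow ℓ' v' * aPow r₀ ∈ DehnTwist.vertGp := by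
    intro v'
    rcases hopt with ⟨-, h2⟩ | ⟨-, h2⟩
    · rw [h2]; exact conj_betaPow_succ_mem_vertGp _ _
    · rw [h2]; exact conj_betaPow_mem_vertGp _ _
  have hℓℓ' : ℓ ≠ ℓ' := by
    intro h0
    have e : ZHatLevel.eta (i₀ - i₁) = 1 := by
      rw [ZHatLevel.eta_eq_zpow, zpow_sub, ← ZHatLevel.eta_eq_zpow, ← ZHatLevel.eta_eq_zpow, ← hℓ, ← hℓ', h0,
        mul_inv_cancel]
    exact bPow_eta_ne_one (sub_ne_zero.mpr hi) (by rw [e]; exact map_one bPow)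
  have hβcx : (hHat l βc).x = 0 := by rw [hβc, hHat_betaPow]
  have hyU : y ∈ Uhat l := by
    rw [hy, conj_mem_Uhat_iff_of_x_eq_zero hβcx]; exact hvU
  -- (C): the image is `b`-type, non-trivial
  obtain ⟨g₀, μ, hg⟩ := (H.res.btype _ hyU).1 ((isBType_betaPow ℓ' v).conj βc)
  have hμ : bPow μ ≠ 1 := by
    intro h0
    apply hv
    rw [h0, mul_one, mul_inv_cancel] at hg
    have := H.res.eq_one_of_psi_eq_one hyU hg
    rw [hy, mul_inv_eq_one, mul_eq_left, betaPow_eq_one_iff] at this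
    rw [this]; exact map_one bPow
  -- (θ) on `U‴`: `β_c⁻¹ Ψ′(y) β_c` is torus-Adams-stable
  have key : ∀ σ ∈ U3 p l U₀, twist (chi p σ) (βc⁻¹ * g₀ * bPow μ * (βc⁻¹ * g₀)⁻¹) =
      powHat (βc⁻¹ * g₀ * bPow μ * (βc⁻¹ * g₀)⁻¹) (chi p σ zOne) := by
    intro σ hσ
    have hσ0 : σ ∈ U₀ := (Subgroup.mem_inf.mp hσ).1
    have hσl : σ ∈ torusCong p l := (Subgroup.mem_inf.mp hσ).2
    -- the axis factor
    set c := betaPow ℓ (chi p σ k * k⁻¹) with hc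
    have hcU : c ∈ Uhat l := betaPow_chi_div_mem_Uhat hσl ℓ k
    have hcfix : Ψ c = c := H.psi_axis i₀ hcU
    have hθc : twist (chi p σ) βc = c * βc := twist_betaPow_eq_mul σ ℓ k
    -- `θ(y) = c · y^{χ1} · c⁻¹`
    have hθy : twist (chi p σ) y = c * powHat y (chi p σ zOne) * c⁻¹ := by
      rw [hy, map_mul, map_mul, map_inv, hθc, twist_betaPow_eq_powHat, powHat_conj]; group
    have h1 : twist (chi p σ) (Ψ y) = c * powHat (Ψ y) (chi p σ zOne) * c⁻¹ := by
      rw [← H.res.torus σ hσ0 y hyU, hθy, H.res.mul _ (mul_mem hcU (powHat_mem_Uhat hyU _)) _ (inv_mem hcU),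
        H.res.mul _ hcU _ (powHat_mem_Uhat hyU _), hcfix, H.res.psi_inv hcU, hcfix, H.res.psi_powHat hyU]
    rw [hg] at h1
    -- conjugate by `β_c⁻¹`
    have eX : βc⁻¹ * g₀ * bPow μ * (βc⁻¹ * g₀)⁻¹ = βc⁻¹ * (g₀ * bPow μ * g₀⁻¹) * βc := by group
    have pc : powHat (βc⁻¹ * (g₀ * bPow μ * g₀⁻¹) * βc) (chi p σ zOne) =
        βc⁻¹ * powHat (g₀ * bPow μ * g₀⁻¹) (chi p σ zOne) * βc := by
      simpa only [inv_inv] using powHat_conj βc⁻¹ (g₀ * bPow μ * g₀⁻¹) (chi p σ zOne)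
    rw [eX, pc, map_mul, map_mul, map_inv, hθc, h1]
    group
  obtain ⟨r, hr⟩ := exists_eq_betaPow_of_twist_eq_powHat (U3 p l U₀) hμ key
  have hgr : Ψ y = βc * betaPow r μ * βc⁻¹ := by
    rw [hg, ← hr]; group
  -- (D′) exact, at `t := η(1)^m`: `d_{r₀,t}⁻¹ d_{r,t} ∈ L_r`
  set t : ZH := zOne ^ (m : ℕ) with ht
  have hyP : (aPow r₀)⁻¹ * y * aPow r₀ ∈ DehnTwist.vertGp := by
    rw [hy, show (aPow r₀)⁻¹ * (βc * betaPow ℓ' v * βc⁻¹) * aPow r₀ = ((aPow r₀)⁻¹ * βc * aPow r₀) *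
      ((aPow r₀)⁻¹ * betaPow ℓ' v * aPow r₀) * ((aPow r₀)⁻¹ * βc * aPow r₀)⁻¹ by group]
    exact mul_mem (mul_mem (hmemc k) (hmemb v)) (inv_mem (hmemc k))
  have hD1 : Ψ (Dp t y) = dElt r₀ t * (βc * betaPow r μ * βc⁻¹) * (dElt r₀ t)⁻¹ := by
    have hdU : dElt r₀ t ∈ Uhat l := dElt_mem_Uhat (level_pow_eq_one_of_dvd H.res.dvd zOne)
    rw [Dp_eq_conj_of_mem hyP, H.res.mul _ (mul_mem hdU hyU) _ (inv_mem hdU), H.res.mul _ hdU _ hyU,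
      H.res.psi_inv hdU, hr₀, ht, H.dElt_fixed zOne j₀, ← ht, ← hr₀, hgr]
  have hD2 : Ψ (Dp t y) = (dElt r₀ t * βc * (dElt r₀ t)⁻¹) * (dElt r t * betaPow r μ * (dElt r t)⁻¹) *
      (dElt r₀ t * βc * (dElt r₀ t)⁻¹)⁻¹ := by
    rw [ht, H.dexact zOne y hyU, ← ht, hgr, map_mul, map_mul, map_inv, Dp_eq_conj_of_mem (hmemc k),
      Dp_eq_conj_of_mem (conj_betaPow_mem_vertGp r μ)]
  have hcomm : ((dElt r₀ t)⁻¹ * dElt r t) * betaPow r μ * ((dElt r₀ t)⁻¹ * dElt r t)⁻¹ = betaPow r μ := by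
    have e := hD1.symm.trans hD2
    calc ((dElt r₀ t)⁻¹ * dElt r t) * betaPow r μ * ((dElt r₀ t)⁻¹ * dElt r t)⁻¹
        = (dElt r₀ t * βc)⁻¹ * ((dElt r₀ t * βc * (dElt r₀ t)⁻¹) * (dElt r t * betaPow r μ * (dElt r t)⁻¹) *
            (dElt r₀ t * βc * (dElt r₀ t)⁻¹)⁻¹) * (dElt r₀ t * βc) := by group
      _ = (dElt r₀ t * βc)⁻¹ * (dElt r₀ t * (βc * betaPow r μ * βc⁻¹) * (dElt r₀ t)⁻¹) * (dElt r₀ t * βc) := by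
          rw [← e]
      _ = betaPow r μ := by group
  -- so `(d_{r₀}⁻¹ d_r)` centralises `β_r^μ`: it is `β_r^w`
  have hB : (aPow r)⁻¹ * ((dElt r₀ t)⁻¹ * dElt r t) * aPow r ∈ bAxis := by
    apply mem_bAxis_of_commute_bPow hμ
    have hc' : ((dElt r₀ t)⁻¹ * dElt r t) * (aPow r * bPow μ * (aPow r)⁻¹) * ((dElt r₀ t)⁻¹ * dElt r t)⁻¹ =
        aPow r * bPow μ * (aPow r)⁻¹ := hcomm
    set gg := (dElt r₀ t)⁻¹ * dElt r t
    calc (aPow r)⁻¹ * gg * aPow r * bPow μ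
        = (aPow r)⁻¹ * (gg * (aPow r * bPow μ * (aPow r)⁻¹) * gg⁻¹) * (gg * aPow r) := by group
      _ = (aPow r)⁻¹ * (aPow r * bPow μ * (aPow r)⁻¹) * (gg * aPow r) := by rw [hc']
      _ = bPow μ * ((aPow r)⁻¹ * gg * aPow r) := by group
  obtain ⟨w, hw⟩ := (mem_bAxis_iff _).1 hB
  have heq : dElt r t * betaPow r w⁻¹ = dElt r₀ t * betaPow r₀ 1 := by
    rw [betaPow_one, mul_one, betaPow_inv, betaPow, hw]; group
  -- the wreath lemma: `r₀⁻¹ r ∈ {0, ±1}`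
  have hW := wreath_input_of_dElt_eq heq
  rw [ht, zOne_pow_mul_zOne_pow] at hW
  have htt : bPow (t * t) ≠ 1 := by
    rw [ht, zOne_pow_mul_zOne_pow]; exact bPow_eta_ne_one (by positivity)
  rcases eq_of_cElt_eq (by positivity : 0 < 2 * (m : ℕ)) hW with h0 | h1 | h1
  · -- `r = r₀`
    have hr' : r = r₀ := by rw [inv_mul_eq_one] at h0; exact h0.symm
    rcases hopt with ⟨hiℓ, hiℓ'⟩ | ⟨hiℓ, hiℓ'⟩
    · -- `r₀ = ℓ` is the conjugator's line — commuting trick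
      exfalso
      have hgℓ : Ψ y = betaPow ℓ μ := by
        rw [hgr, hr', ← hiℓ, hβc]; rw [betaPow_comm]; rw [mul_inv_cancel_right]
      have hκ : Ψ (betaPow ℓ (ZHatLevel.eta (l : ℤ))) = betaPow ℓ (ZHatLevel.eta (l : ℤ)) := H.psi_axis i₀ (kappa_mem_Uhat i₀)
      have hc2 : y * betaPow ℓ (ZHatLevel.eta (l : ℤ)) = betaPow ℓ (ZHatLevel.eta (l : ℤ)) * y := by
        rw [← H.res.commute_iff hyU (kappa_mem_Uhat i₀), hgℓ, hκ]; exact betaPow_comm _ _ _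
      rw [hy, betaPow, show βc * (aPow ℓ' * bPow v * (aPow ℓ')⁻¹) * βc⁻¹ = (βc * aPow ℓ') * bPow v * (βc * aPow ℓ')⁻¹ by group,
        betaPow] at hc2
      have := inv_mul_mem_bAxis_of_commute hv (bPow_eta_l_ne_one l) hc2
      rw [hβc, betaPow, show (aPow ℓ * bPow k * (aPow ℓ)⁻¹ * aPow ℓ')⁻¹ * aPow ℓ = (aPow ℓ')⁻¹ * aPow ℓ * (bPow k)⁻¹ by group]
        at this
      have := (Subgroup.mul_mem_cancel_right _ (inv_mem (bPow_mem_bAxis k))).mp this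
      rw [← aPow_inv, ← aPow_mul, aPow_mem_bAxis_iff, inv_mul_eq_one] at this
      exact hℓℓ' this.symm
    · -- `r₀ = ℓ'`: the claim
      refine ⟨μ, hμ, ?_⟩
      rw [hgr, hr', ← hiℓ']
  · -- `r = r₀ · η1`
    rw [inv_mul_eq_iff_eq_mul] at h1
    rcases hopt with ⟨hiℓ, hiℓ'⟩ | ⟨hiℓ, hiℓ'⟩
    · -- `r = r₀ η1 = ℓ'`: the claim
      refine ⟨μ, hμ, ?_⟩
      rw [hgr, h1, ← hiℓ']
    · -- `r = r₀ η1 = ℓ`: commuting trick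
      exfalso
      have hgℓ : Ψ y = betaPow ℓ μ := by
        rw [hgr, h1, ← hiℓ, hβc]; rw [betaPow_comm]; rw [mul_inv_cancel_right]
      have hκ : Ψ (betaPow ℓ (ZHatLevel.eta (l : ℤ))) = betaPow ℓ (ZHatLevel.eta (l : ℤ)) := H.psi_axis i₀ (kappa_mem_Uhat i₀)
      have hc2 : y * betaPow ℓ (ZHatLevel.eta (l : ℤ)) = betaPow ℓ (ZHatLevel.eta (l : ℤ)) * y := by
        rw [← H.res.commute_iff hyU (kappa_mem_Uhat i₀), hgℓ, hκ]; exact betaPow_comm _ _ _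
      rw [hy, betaPow, show βc * (aPow ℓ' * bPow v * (aPow ℓ')⁻¹) * βc⁻¹ = (βc * aPow ℓ') * bPow v * (βc * aPow ℓ')⁻¹ by group,
        betaPow] at hc2
      have := inv_mul_mem_bAxis_of_commute hv (bPow_eta_l_ne_one l) hc2
      rw [hβc, betaPow, show (aPow ℓ * bPow k * (aPow ℓ)⁻¹ * aPow ℓ')⁻¹ * aPow ℓ = (aPow ℓ')⁻¹ * aPow ℓ * (bPow k)⁻¹ by group]
        at this
      have := (Subgroup.mul_mem_cancel_right _ (inv_mem (bPow_mem_bAxis k))).mp this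
      rw [← aPow_inv, ← aPow_mul, aPow_mem_bAxis_iff, inv_mul_eq_one] at this
      exact hℓℓ' this.symm
  · -- `r = r₀ · η(−1)`: excluded — `d_{r₀} = d_{r₀η(−1)} β_{r₀}^{2t}` puts `β_{r₀}^{−2t}` on the line `L_r`
    exfalso
    rw [inv_mul_eq_iff_eq_mul] at h1
    have e0 : ZHatLevel.eta (-1) * zOne = 1 := by
      rw [zOne, eta_mul_eta, show (-1 : ℤ) + 1 = 0 by norm_num, ZHatLevel.eta_eq_zpow, zpow_zero]
    have hr0 : r₀ = r * zOne := by rw [h1, mul_assoc, e0, mul_one]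
    have hd : dElt r₀ t = dElt r t * betaPow r₀ (t * t) := by
      conv_lhs => rw [hr0]
      rw [dElt_succ, ← hr0]
    -- from `heq`: `d_r β_r^{w⁻¹} = d_{r₀}` so `β_r^{w⁻¹} = β_{r₀}^{2t}`
    rw [betaPow_one, mul_one, hd] at heq
    have h2 : betaPow r w⁻¹ = betaPow r₀ (t * t) := mul_left_cancel heq
    have hne : r ≠ r₀ := by
      rw [h1]; intro h
      have : ZHatLevel.eta (-1) = 1 := mul_eq_left.mp h
      exact bPow_eta_ne_one (k := -1) (by norm_num) (by rw [this]; exact map_one bPow)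
    have h3 := betaPow_eq_one_of_eq_of_ne hne h2
    rw [h3] at h2
    have h4 : t * t = 1 := (betaPow_eq_one_iff _ _).1 h2.symm
    exact htt (by rw [h4]; exact map_one bPow)

end EndVertices

/-! ## §14 (residue) Conjugate `b`-powers have equal exponents -/

section StableLetters

variable {l : ℕ+}

/-- Conjugate `b`-powers have equal exponents: `h b^{μ'} h⁻¹ = b^μ`, `b^{μ'} ≠ 1` ⇒ `h ∈ B` and `μ = μ'`.
[cite: MochizukiSemiAnbd2006, Ex. 2.10 p.31] -/
theorem mem_bAxis_and_eq_of_conj_bPow_eq {h : F₂hatT} {μ μ' : ZH} (hμ' : bPow μ' ≠ 1)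
    (e : h * bPow μ' * h⁻¹ = bPow μ) : h ∈ bAxis ∧ μ = μ' := by
  have hB : h ∈ bAxis := mem_bAxis_of_conj_bPow_mem hμ' (by rw [e]; exact bPow_mem_bAxis μ)
  refine ⟨hB, ?_⟩
  obtain ⟨w, rfl⟩ := (mem_bAxis_iff _).1 hB
  rw [bPow_comm, mul_inv_cancel_right] at e
  exact (bPow_injective e).symm

end StableLetters

/-! ## §15 (S9 of PL3-R2, the (G″) device) TWO-SYLLABLE ELEMENTS ARE FIXED -/

section TwoSyllable

variable {p : ℕ} [Fact p.Prime] {l : ℕ+} {U₀ : Subgroup (GQp p)} {m : ℕ+} {f' : F₂hatT} {Ψ : F₂hatT → F₂hatT}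

/-- `ê` kills `Π_v` (both branches lie on `Ker ê`, which is closed). [cite: MochizukiAbsTopII2013, Prop 1.3 (ii) p.11] -/
theorem eHat_eq_one_of_mem_vertGp {y : F₂hatT} (hy : y ∈ DehnTwist.vertGp) : eHat y = 1 := by
  have hle : DehnTwist.vertGp ≤ eHat.toMonoidHom.ker := by
    refine Subgroup.topologicalClosure_minimal _ ?_ ?_
    · refine sup_le ?_ ?_
      · intro x hx; exact eHat_eq_one_of_mem_bAxis hx
      · intro x hx
        rw [Subgroup.mem_smul_pointwise_iff_exists] at hx
        obtain ⟨z, hz, rfl⟩ := hx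
        rw [MonoidHom.mem_ker, MulAut.smul_def, MulAut.conj_apply]
        change eHat (_ * z * _) = 1
        rw [map_mul, map_mul, map_inv, eHat_eq_one_of_mem_bAxis hz, mul_one, mul_inv_cancel]
    · have : ((eHat.toMonoidHom.ker : Subgroup F₂hatT) : Set F₂hatT) = eHat ⁻¹' {1} := by
        ext y; simp [MonoidHom.mem_ker]
      rw [this]
      exact (isClosed_singleton.preimage eHat.continuous)
  exact hle hy

/-- `ê(y) = 1` when `a^{-s} y a^{s} ∈ Π_v`. [cite: MochizukiAbsTopII2013, Prop 1.3 (ii) p.11] -/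
theorem eHat_eq_one_of_conj_mem_vertGp {s : ZH} {y : F₂hatT} (hy : (aPow s)⁻¹ * y * aPow s ∈ DehnTwist.vertGp) :
    eHat y = 1 := by
  have h := eHat_eq_one_of_mem_vertGp hy
  rw [map_mul, map_mul, map_inv, eHat_aPow] at h
  rwa [ZHatCompletion.mul_comm, ← mul_assoc, mul_inv_cancel, one_mul] at h

end TwoSyllable

end Literature.AnabelianGeometry.EtaleTheta.SettingModel.Slice2

end
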